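import Summits.ABC.ABC.Theorems.YuMatveevShapeRatCloses
import Literature.NumberTheory.DiophantineGeometry.ApproximationBoundRat
import Literature.NumberTheory.DiophantineGeometry.SubexponentialAbcWithoutRadAProofs
import HarnessLib

/-!
# A1.L's abc-facing payoff BY NAME: the 2025 Pasten–Sepúlveda-Manzo theorems hold unconditionally

`Summits/ABC/ABC/Theorems/SubexponentialAbcWithoutRadAHolds.lean` — cell `abc-stewartyu` (lit g14 draft, TRANCHE PLAN v1.2 §6;
to be filed the day route `YuMatveevShapeRat` closes, `--supports <assembly item stmt-ABC-20505>` or by the closer seat).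
PLACEMENT: Summits-side, exactly as the M3 precedent `StewartYuHolds.lean` (`Summit.ABC.ABC.Theorems.stewart_yu_holds`):
a Literature file cannot import the Summits-side rung proof (`import.summits-from-literature`), so the WAKE's path
`Literature/…/SubexponentialAbcWithoutRadAHolds.lean` is replaced by this one. PROOFS ONLY (0 defs, 0 facts): each theorem is
`obtain ⟨K, hK, hP⟩ := <rung>; exact <landed K-parametric theorem> hK hP`.

* `pastenSepulvedaManzo2025_thm_2_2_holds` — [cite: PastenSepulvedaManzo2025Abcd, Thm 2.2] via `…_thm_2_2_of_approximationBound`;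
* `pastenSepulvedaManzo2025_thm_1_3_holds` — «abc without rad(a)» [cite: PastenSepulvedaManzo2025Abcd, Thm 1.3] via `…_thm_1_3_of_thm_2_2`;
* `pastenSepulvedaManzo2025_thm_1_6_holds` — the abcd theorem [cite: PastenSepulvedaManzo2025Abcd, Thm 1.6] via `…_thm_1_6_of_approximationBound`;
* (dropped 22:3xZ, lit g15: the `_of_rung` second proofs of `BakerMethodBounds` / `stewartYu2001_thm2` — the gate de-dups BY STATEMENT
  (`dedup.landed` vs ✓ `bakerMethodBounds_holds` / `stewartYu2001_thm2_holds`, p2 g8 22:25:49Z); the second, Kummer-free path is recorded in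
  `YuMatveevShapeRatCloses.lean`'s docstring only.)
WHAT THIS IS NOT: new mathematics; an abc claim (these are abc-type bounds in special regimes, printed and proved in 2025).
-/

-- `Summit.<Summit>.<Problem>` is the mandated summit-side namespace (CONVENTIONS §2); for the single-conjunct summit `ABC` the two
-- coincide, so the duplicate `ABC.ABC` is deliberate.
set_option linter.dupNamespace false

namespace Summit.ABC.ABC.Theorems

open Literature.NumberTheory.DiophantineGeometry

/-- **Pasten–Sepúlveda-Manzo 2025, Theorem 2.2, unconditionally** (from the A1.L rung `Dioph.approximationBound_rat`).
[cite: PastenSepulvedaManzo2025Abcd, Thm 2.2] -/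
theorem pastenSepulvedaManzo2025_thm_2_2_holds : PastenSepulvedaManzo2025_thm_2_2 := by
  obtain ⟨K, hK, hP⟩ := approximationBound_rat_holds
  exact PastenSepulvedaManzo2025_thm_2_2_of_approximationBound hK hP

/-- **Pasten–Sepúlveda-Manzo 2025, Theorem 1.3 («abc without rad(a)»), unconditionally.**
[cite: PastenSepulvedaManzo2025Abcd, Thm 1.3] -/
theorem pastenSepulvedaManzo2025_thm_1_3_holds : PastenSepulvedaManzo2025_thm_1_3 :=
  PastenSepulvedaManzo2025_thm_1_3_of_thm_2_2 pastenSepulvedaManzo2025_thm_2_2_holds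

/-- **Pasten–Sepúlveda-Manzo 2025, Theorem 1.6 (abcd), unconditionally.** [cite: PastenSepulvedaManzo2025Abcd, Thm 1.6] -/
theorem pastenSepulvedaManzo2025_thm_1_6_holds : PastenSepulvedaManzo2025_thm_1_6 := by
  obtain ⟨K, hK, hP⟩ := approximationBound_rat_holds
  exact PastenSepulvedaManzo2025_thm_1_6_of_approximationBound hK hP

end Summit.ABC.ABC.Theorems
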